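import Mathlib
import HarnessLib
import HarnessLib.Audit
import Summits.KontsevichZagierPeriods.Statement
import HarnessLib.Audit.Status.Attr

/-!
Route: WeightFloor

# Route WeightFloor — boundary regularity sets the weight floor — smooth stones are complete
1-periods; the cornerless planar layer of VolumeForm splits into bounding and abelian stones

It suffices to show VOLUME FORM (frame shared verbatim with routes BoundaryLevel /
SymplecticScissors / HardSphereVirial /
SphericalSchlafli, stmt-3814, with the shared Assembly stmt-3822 `VolumeForm →
KontsevichZagierPeriods`): for every N, two integrand-1
representations of dimension N — two ℚ-semialgebraic sets of finite volume — with the same value are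
KZ-equivalent. This route realises card
smooth-stones-never-rational-weight-floor (gen 2; the gen-1 route SmoothStones was retired
`not-a-thesis` only because its assembly stopped at
the sector) and owns the LAYER "N = 2, cornerless bodies": SMOOTH STONES, compact regular-closed
planar sets whose frontier lies in the smooth
real locus {p = 0, ∇p ≠ 0} of some p ∈ ℚ[x,y]. The mechanism: boundary regularity of a volume
representation bounds the WEIGHT FLOOR of its
value — one Newton–Leibniz move with the polynomial primitive y (Green) turns the area of a smooth
stone into a COMPLETE 1-period Σ±∮ x dy
(closed paths on a smooth affine curve: weights 1–2, no weight 0, no boundary divisor), whereas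
corners give incomplete periods (weight 0:
algebraic summands, logarithms). Declared up front: the cruxes certify the layer SmoothOvalSector
(support; = BoundingStonePairs ∧
AbelianStonePairs by the support StoneDichotomy, excluded middle on 'Area ∈ ℚ̄·π'), they do not
decompose X; the deciding theorem is the
shared frame.
Lean: `∀ ⦃N : ℕ⦄ (r r' : Literature.NumberTheory.Transcendental.KZ.IntegralRep N), (∀ x ∈ r.domain,
r.integrand x = 1) → (∀ x ∈ r'.domain, r'.integrand x = 1) → r.value = r'.value →
Literature.NumberTheory.Transcendental.KZ.Equivalent r r'`

## Assembly
The deciding theorem is the shared frame: `closes (hV : VolumeForm) (hA : Assembly) :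
KontsevichZagierPeriods := hA hV` (glue.lean,
sorry-free, certified `--native`), with Assembly = stmt-3822 (VolumeForm → KontsevichZagierPeriods:
difference of volumes by one
Newton–Leibniz move with primitive t on the subgraph band, slabs to equalise dimensions, disjoint
translates, soundness — shared with
BoundaryLevel / SymplecticScissors / HardSphereVirial / SphericalSchlafli, grounded and checked
there as provable from tree ingredients).
Inside the layer: StoneDichotomy (proved in Sketch.lean) gives BoundingStonePairs →
AbelianStonePairs → SmoothOvalSector, LayerOfFrame
(proved) gives VolumeForm → SmoothOvalSector, GenusZeroStonePairs is the genus-0 case of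
BoundingStonePairs, GreenBridge the common first
move, ConicStones / BeanStoneDisc the provable-now calibrations, SmoothStonesTranscendental the
value-side calibration; none of them is
consumed by `closes`. A layer route exactly like BoundaryLevel and SymplecticScissors: the cruxes
certify the layer, they do not imply the frame.

Rationale: WHY THIS LINE. Green's formula read inside the rules (one `newtonLeibnizRel` per cylindrical band,
primitive y given in advance) makes the area of a smooth
stone a period of the 1-motive [0 → J(U)] of the smooth affine curve U carrying the boundary ovals,
so the layer is the sub-sector of PlanarAreas
(stmt-4990, LowDimension/HodgeLevel; SymplecticScissors' N = 2 layer) where Huber–Wüstholz's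
relation theory is simplest: relations among
COMPLETE periods come only from exact forms, residues at infinity and correspondences/isogenies
between (generalised) Jacobians
(HuberWustholz2022 Thm 9.10, Thm 13.7; closed paths: Thm 13.9, Prop 13.11, Cor 13.13 read pp.
124–126 — 'a period over a closed cycle is
transcendental or zero', Wustholz1989), with no boundary divisor and no tangential base point. The
value class is decidable
(SertozOuaknineWorrell2025) and splits the layer: BOUNDING stones (Area = β·π, β real algebraic: all
genus-0 stones, certified by residues /
a rational parametrisation; the genus-0 case is transcendence-free and closes by an explicit engine
— partial fractions over ℚ̄∩ℝ, Cauchy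
kernels normalised by affine changes of variables, log-divergent brackets killed by a RATIONAL
two-variable unfolding) and ABELIAN stones
(genuine periods of positive-genus curves: certificates = correspondences acting sheetwise, cf.
routes MultivaluedCoV / IsogenyCertificates).
Imported: transcendence and linear relations of 1-periods (HuberWustholz2022, Masser1975), mixed
Hodge theory of smooth curves (Deligne1971:
weight floor), real algebraic geometry of ovals and cylindrical decomposition (BochnakCosteRoy1998,
BasuPollackRoy2006), certified period
numerics for the falsifier (LairezMezzarobbaSafeyeldin2019, BreidingKohnSturmfels2024); history:
Leibniz's 1691 problem (Arnold1990,
HuberWustholz2022 p. 124), Masser2026 (nearest print, paywalled). Versus prior routes: BoundaryLevel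
applies the same divergence lens one
dimension up with the skin's Hodge LEVEL as parameter (cubic skins, N = 3, 4) and is silent in the
plane; SymplecticScissors attacks all of
N = 2 through the full HW generator list on period symbols with boundary; LowDimension stops at d ≤
1 (Baker, proved in tree); nobody
isolates the complete-period sub-layer, its bounding/abelian split, the transcendence-free genus-0
engine, or records the value theorem
'no smooth stone has algebraic area' (SmoothStonesTranscendental, support). Negatives index (1
entry, KinematicPlaneConvex: empty-set leak):
every item here carries compactness and non-empty interior.

RANKED CRUXES. #0 VolumeForm (target) — X — for every N, two integrand-1 integral representations of
dimension N with equal value are KZ-equivalent (shared frame stmt-3814); attacked here on the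
cornerless planar layer (smooth stones). (why it might fail: summit-equivalent (ViuSos2021 Thm 1.1 /
CressonViusos2022 §1: every period is a volume): from N = 3 on it contains π², ζ(3), products of
1-periods (strength barriers); only the smooth-stone layer of N = 2 is claimed here.)
[CressonViusos2022, ViuSos2021, KontsevichZagier2001]
#2 AbelianStonePairs (crux) — the abelian half of the layer (card (S), hardest): two smooth stones
(integrand 1; domains compact, regular closed, non-empty interior, frontier in the smooth real locus
of some p ∈ ℚ[x,y]) with equal area NOT of the form β·π (β real algebraic) are KZ-equivalent. After
the Green move both areas are complete periods of second/third-kind forms on smooth curves of genus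
≥ 1; by Huber–Wüstholz (Thm 9.10/13.7, cited, a hypothesis of no item) the equality is induced by
exact forms, residues and a correspondence between the generalised Jacobians (isogenies, CM, split
Jacobians as HW Ex. 14.5(3): y² = x⁶+1 → y² = x³+1); the claim is that each certificate is a chain:
fold maps (x,y) ↦ (x²,y) are single 2-dim changes of variables on half-stones, general
correspondences act sheetwise (route MultivaluedCoV), isogenies as in
IsogenyCertificates/HermiteRigidity. First instance (support FermatQuarticStone, provable now): the
quartic egg {x⁴+y² ≤ 1} (genus 1) and the Fermat stone {x⁴+y⁴ ≤ 8/9} (genus 3) both weigh 4ϖ/3;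
next: the genus-2 stone {x⁶+y² ≤ 1} ((2/3)B(1/6,3/2)) against stones on its elliptic quotient y² =
x³+1. [deps: GreenBridge] [difficulty: XL] (why it might fail: HW relations among complete periods
involve non-split torus extensions of J(C) (third-kind parts of x dy at infinity) and CM/isogeny
factors; one equal-area pair whose certificate no sheetwise correspondence + plane Stokes chain
realises refutes it (and the summit).) [HuberWustholz2022, Masser1975, SertozOuaknineWorrell2025,
KontsevichZagier2001]
#3 BoundingStonePairs (crux) — the bounding half: two smooth stones with equal area of the form β·π
(β real algebraic) are KZ-equivalent. Expected to be exactly the case where the oriented boundary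
cycle bounds in the complexified curve, Area = 2πi·Σ res(x dy) (all genus-0 stones; ovals of
one-oval dividing curves of even genus); the chain must realise the residue theorem — by a rational
parametrisation (genus 0: crux GenusZeroStonePairs) or by Stokes on a ℚ-semialgebraic 2-chain of the
complex curve in ℝ⁴ (UnfoldedStokes' engine) — and then connect two π-multiples through the disc
normal form [ℝ, β/(1+t²)] ~ disc of radius √β (one change of variables with algebraic Jacobian).
[deps: GreenBridge, GenusZeroStonePairs] [difficulty: L] (why it might fail: beyond genus 0 'Area =
βπ' is certified by residues on a 2-chain in the complexified curve; as moves this needs Stokes on a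
semialgebraic 2-chain in ℝ⁴ (open crux of UnfoldedStokes); the first case (one-oval dividing sextic,
genus 2) may admit no such chain.) [HuberWustholz2022, KontsevichZagier2001, Arnold1990,
BochnakCosteRoy1998]
#4 GenusZeroStonePairs (crux) — genus-zero stones (special case of crux 3, FIRST prover target,
transcendence-free): if the frontiers of both stones are covered by finitely many rational arcs t ↦
(u/w, v/w)(t) with real-algebraic coefficients (w without real zeros), equal area implies
KZ-equivalence. Engine: Green (GreenBridge) → one change of variables per monotone arc x = X(t)
gives RATIONAL integrands Y·X′ over ℚ̄∩ℝ → merge to [ℝ, R], R = O(t⁻²) pole-free on ℝ, ∫R = βπ, β =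
2i·Σ_(Im>0) res ∈ ℚ̄∩ℝ → partial fractions by 1b (integrable pieces only): Cauchy kernels
δa/((t−b)²+a²) ↦ [ℝ, δ/(1+t²)] by t ↦ b + at, merged by 1b; higher-order poles telescope by
Newton–Leibniz with RATIONAL primitives after t = s/(1−s²); each log-divergent bracket
(t−b)/((t−b)²+a²) − t/(t²+1) (coefficients sum to 0) equals ∫₀¹ ∂_s[(t−b(s))/((t−b(s))²+a(s)²)] ds
along (b(s), a(s)) = (sb, 1+s(a−1)), whose integrand is ∂_t N, N = (a a′ − (t−b) b′)/((t−b)²+a²)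
rational and → 0 at ±∞ — so Newton–Leibniz in s (backwards), the swap (t,s) ↦ (s,t) and
Newton–Leibniz in t kill it with semialgebraic primitives only. Both sides reach the SAME [ℝ,
β/(1+t²)] (β = Area/π). First instance: BeanStoneDisc. [deps: GreenBridge] [difficulty: L] (why it
might fail: false only with the summit; the risk is the engine — Newton–Leibniz needs primitives
continuous on CLOSED fibres after compactifying ℝ, critical points of X(t) must be cut by null
walls, and a log bracket resisting rational unfolding makes it as hard as PlanarAreas.)
[KontsevichZagier2001, HuberWustholz2022, BochnakCosteRoy1998, Baker1975]
#9 SmoothOvalSector (support) — THE LAYER (card (S)): two integrand-1 representations over smooth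
stones (compact, regular closed, non-empty interior, frontier in the smooth real locus of some p ∈
ℚ[x,y]) with equal area are KZ-equivalent. A literal special case of VolumeForm (support
LayerOfFrame) and of PlanarAreas (stmt-4990); closes from cruxes 2 and 3 by StoneDichotomy.
Bookkeeping used throughout: the frontier of such σ is open and closed in the 1-manifold {p = 0, ∇p
≠ 0}(ℝ) (local two-sidedness of a regular closed set along a smooth arc), hence a finite union of
whole ovals. [difficulty: XL] [KontsevichZagier2001, HuberWustholz2022, BochnakCosteRoy1998]
#9 StoneDichotomy (support) — glue of the layer (pure logic, proved in the folder's Sketch.lean as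
`stoneDichotomy_holds`, 4 lines): BoundingStonePairs → AbelianStonePairs → SmoothOvalSector, by
excluded middle on '∃ β real algebraic, Area = β·π'. [difficulty: provable-now]
[KontsevichZagier2001]
#9 LayerOfFrame (support) — the layer is a specialisation of the frame: VolumeForm →
SmoothOvalSector (proved in Sketch.lean as `layerOfFrame_holds`, 2 lines; with
`volumeForm_of_summit` there it makes the kill criterion formal: ¬SmoothOvalSector ⇒ ¬VolumeForm ⇒
¬summit). [difficulty: provable-now] [KontsevichZagier2001]
#9 GreenBridge (support) — the Green move inside the rules (card W1): every integrand-1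
representation over a smooth stone is congruent modulo `KZ.relations` to a ℤ-combination of
1-dimensional representations (typed loosely as membership in the closure of 1-dim generators;
intended chain: cylindrical decomposition into vertical bands — rule 1a, null walls are relations —
and ONE Newton–Leibniz move per band with the polynomial primitive F = y, giving integrands y_top(x)
− y_bot(x), real branches of the boundary curve, split by 1b; provers of cruxes 2–4 re-prove the
sharp form they need with `--supports`). [difficulty: M] [KontsevichZagier2001, BasuPollackRoy2006,
BochnakCosteRoy1998]
#9 ConicStones (support) — sanity anchor (d = 2 analogue of LowDimension's DimZero): two smooth
stones cut out by polynomials of total degree ≤ 2 — necessarily filled ellipses over ℚ (no compact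
regular-closed set has its frontier inside two lines minus their crossing, a parabola, or an empty
smooth locus) — with equal area are KZ-equivalent: ONE affine change of variables with
real-algebraic entries and determinant 1 (equal areas π/√det A = π/√det A′), whose graph is
ℚ-semialgebraic; e.g. {x²+4y² ≤ 4} ~ {x²+y² ≤ 2} via (x,y) ↦ (x/√2, √2·y). [difficulty:
provable-now] [KontsevichZagier2001, BochnakCosteRoy1998]
#9 BeanStoneDisc (support) — first closed instance of the layer between DIFFERENT curves
(calibration of GreenBridge + GenusZeroStonePairs, provable now): the bean stone K = {4y² ≤
(1−x²)(2+x)², x ≥ −1} — bounded by the smooth oval of the rational quartic 4y² = (1−x²)(2+x)² =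
image of θ ↦ (cos θ, sin θ(1 + ½cos θ)), whose only singularity is the acnode (−2, 0), cut away by x
≥ −1; ∇p ≠ 0 on the oval (∂ₓp = 18, −2 at (±1, 0)) — has Area = ∫_(−1)^1 2√(1−x²)(1 + x/2) dx = π +
0 and is KZ-equivalent to the unit disc: Green on both sides (bands over (−1,1), primitive y), 1b
splits 2√(1−x²)(1+x/2) = 2√(1−x²) + x√(1−x²), the odd summand dies by the change x ↦ −x on (−1,0)
plus 1b ([(0,1), x√(1−x²)] + [(0,1), −x√(1−x²)] = [(0,1), 0]), and [(-1,1), 2√(1−x²)] is the disc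
after its own Green move. [difficulty: M] [KontsevichZagier2001, BochnakCosteRoy1998]
#9 FermatQuarticStone (support) — first ABELIAN instance, curves of different genus (calibration of
AbelianStonePairs, provable now, transcendence-free): the quartic egg {x⁴ + y² ≤ 1} (y² = 1 − x⁴,
genus 1, CM by i; area B(1/4,3/2) = 4ϖ/3) and the Fermat stone {x⁴ + y⁴ ≤ 8/9} (genus 3; area
(8/9)^(1/2)·B(1/4,5/4) = 4ϖ/3, as B(1/4,3/2)/B(1/4,5/4) = 2√2/3) are KZ-equivalent. Chain on paper:
Green on both; x = (8/9)^(1/4)u; symmetry + t = x⁴ give Beta representations on (0,1); integration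
by parts = Newton–Leibniz with the algebraic primitives λ·t^a(1−t)^b gives B(1/4,3/2) =
(2/3)B(1/4,1/2), B(1/4,5/4) = (1/2)B(1/4,1/4); the duplication B(1/4,1/4) = √2·B(1/4,1/2) is (0,½) ∪
(½,1), t ↦ 1−t, u = 4t(1−t) (LowdimDuplicationOneThird's pattern at a = 1/4); both sides end at
[(0,1), (2/3)t^(−3/4)(1−t)^(−1/2)]. Certificate behind it: the quotient of the Fermat quartic onto
y² = 1 − x⁴. [difficulty: L] [KontsevichZagier2001, AndrewsAskeyRoy1999, HuberWustholz2022]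
#9 SmoothStonesTranscendental (support) — VALUE CALIBRATION — Leibniz's 1691 problem for whole ovals
(card (T1a); known modulo bookkeeping, hence support): ASSUMING the plane-curve closed-path form of
HuberWustholz2022 Cor. 13.13 (Thm 9.10/9.11 for several components), INLINED as the hypothesis so
that no cite-only fact enters the cone (for p, A, B ∈ ℚ[x,y] and finitely many C¹ 1-periodic loops
γᵢ in the smooth COMPLEX locus of p = 0, an algebraic value of Σ nᵢ∮_γᵢ(A dx + B dy) is zero), every
smooth stone σ has transcendental area. Proof: frontier σ = finitely many whole ovals, Area(σ) = Σ
±∮ x dy > 0 (Green band by band), apply the hypothesis with A = 0, B = x. By soundness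
(`KZ.relations_le_ker_eval_holds`) it separates every smooth stone from every representation with
algebraic value (polygons; Arnold's nodal loop {y² ≤ x² − x⁴, x ≥ 0} of area 2/3). The hypothesis is
verbatim the landed cite-only fact `completePlaneCurvePeriods_zero_or_transcendental`
(OnePeriodsClosedPaths.lean), kept inlined so the unproved fact stays out of the cone. [difficulty:
L] [HuberWustholz2022, Wustholz1989, Arnold1990, Masser2026]

TWO-LAYER PLAN. Foreseen glued splits (k ≤ 3, depth 1), filed only after a crux closes or stalls
with a census: BoundingStonePairs ⇐ GenusZeroStonePairs →
DividingStonePairs → BoundingGlue, where DividingStonePairs = the positive-genus bounding case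
(engine: Stokes on the bounding ℚ-semialgebraic
2-chain of the complexified curve in ℝ⁴, shared with route UnfoldedStokes) and BoundingGlue = 'a
bounding stone is genus-0 or dividing-type'
(Klein/Rokhlin type; the filed split is by value, so this is only the expected geometry).
AbelianStonePairs ⇐ SameCurveStones (two stones on one
curve: exact forms + endomorphisms/CM of one generalised Jacobian) → CorrespondenceStones (different
curves: Hom(J₁, J₂) realised by sheetwise
changes of variables, MultivaluedCoV's move) → AbelianGlue (HW Ch. 13–15: these exhaust the
relations among complete periods; inlined as
antecedent when typed). GenusZeroStonePairs ⇐ GreenToLine (stone ~ [ℝ, R]) →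
RationalLineKernel ([ℝ, R] ∈ relations when ∫R = 0: the unfolding engine) → glue (1b).

KILL CRITERIA. (1) An equal-area pair of smooth stones proved NOT KZ-equivalent (an invariant of the
moves finer than area — cf. routes Neg / RealPeriodGerms) refutes SmoothOvalSector, VolumeForm and
the H21-literal summit at once: close `refuted:SmoothOvalSector` and hand
the witness to Neg / the operator (LayerOfFrame, `volumeForm_of_summit`). (2) ¬AbelianStonePairs or
¬BoundingStonePairs alone: same effect (each is a sub-case of the summit); a refutation of a
PARTICULAR engine only (parametrisation,
unfolding, Stokes, sheetwise correspondence) is a census, not a kill — re-text the crux, keep the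
statement. (3) A smooth stone with ALGEBRAIC area (60-digit PSLQ hit, then a proof) refutes
SmoothStonesTranscendental's bookkeeping or the
reading of HW Cor. 13.13 — drop the support with a note and report upstream; the layer cruxes are
unaffected. (4) Mooted: PlanarAreas (stmt-4990)
or PlanarK0Injective (SymplecticScissors) proved ⇒ SmoothOvalSector follows (close `superseded --by`
that route); VolumeForm / Assembly proved
elsewhere or the summit decided ⇒ everything here is a corollary or moot.

NOT DECOMPOSED YET. The positive-genus bounding case and the same-curve/different-curve split of the
abelian case (Two-layer plan) — children only after
GenusZeroStonePairs or GreenBridge lands (D-0019). The CUBIC-STONE calibration (card (T1c)) — for a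
real lattice with rational q₂, q₃, Δ > 0,
the Weierstrass stone {e₃ ≤ x ≤ e₂, y² ≤ 4x³ − q₂x − q₃} has area −(2/5)q₂H − (3/5)q₃Ω₀ (real period
Ω₀, real quasi-period H; from
d(xy) = (10x³ − (3/2)q₂x − q₃)dx/y), hence is never γ + β·π (β, γ real algebraic) — is NOT filed:
the uniform statement needs Masser's Thm II
(`masser_ellipticPeriods`, cite-only; naming it would make the route unstaffable); the CM case (y² =
4x³ − 4x) follows from the PROVED
`masser_ellipticPeriods_cm_holds` and may be filed as support on demand. The value DICHOTOMY 'Area ∈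
ℚ̄·π or outside the Baker space
ℚ̄ + Σℚ̄·log ℚ̄' (card (T1b)) and CornersCarryLogs (card (T2): c ≥ 2 transversal corners ⇒ Area is a
period of [ℤ^(c−1) → J(U)], Baker/algebraic
summands allowed) need HW Thm 9.10 for general 1-motives (vocabulary the tree lacks) — recorded, not
filed. The n ≥ 3 conjecture SmoothBodies
(smooth real-algebraic skin transverse to infinity ⇒ volume among the periods of H^(n−1) of a smooth
affine variety, weight floor n − 1, hence
never algebraic under Grothendieck's period conjecture) is GPC-strength from surfaces on and is
route BoundaryLevel's business (skin level,
N = 3, 4); its rules shadow NoSmoothChainToPolytope needs 'moves are morphisms of motives' (Ψ, card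
kz-coaction-devissage) and is untypeable today.

CHEAPEST FALSIFIER. Layer: the BeanStoneDisc chain by hand (done on paper: Green twice, 1b, the
reflection x ↦ −x kills the odd part; nothing resisted), then the
first pair needing irrational algebraic scalings and a double pole — the O₂-stone (rational quartic
oval t ↦ ((1−t²)/(1+t²), 2t/(2+t²)), area
(12 − 8√2)π) against the disc {x² + y² ≤ 12 − 8√2}: Green, parametrisation, partial fractions over
ℚ(√2), t ↦ √2·t, one Newton–Leibniz with
a rational primitive for (2+t²)⁻², merge by 1b to [ℝ, (12−8√2)/(1+t²)] on both sides; log-divergent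
brackets (the rational-unfolding step)
first appear for parametrisations with poles off the imaginary axis — ONE bracket that cannot be
unfolded with rational data means rank 4 is
mis-set. Value side: 60-digit areas of a dozen smooth stones of degree 4–6 (holonomic period ODEs,
LairezMezzarobbaSafeyeldin2019 /
BreidingKohnSturmfels2024) and PSLQ against (1, π, π², log 2, log 3, √2, √3): one algebraic or Baker
hit kills SmoothStonesTranscendental's
reading. Hand checks of this session are under Numbers (all consistent: genus-0 values in ℚ̄·π,
positive genus off it); no kit job (compute-free hub).

NUMBERS. ϖ = Γ(¼)²/(2√(2π)) = 2.6220575543; Area{x⁴+y² ≤ 1} = 4ϖ/3 = 3.4960767391 (genus 1, CM by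
i); Area{x⁴+y⁴ ≤ 1} = Γ(¼)²/(2√π) = 3.7081493546
(BreidingKohnSturmfels2024: 3.70815); Area{x⁶+y² ≤ 1} = (2/3)·B(1/6,3/2) = 3.6429759718 (genus 2,
Jacobian isogenous to E×E′); Fermat stone
{x⁴+y⁴ ≤ 8/9}: (8/9)^(1/2)·B(1/4,5/4) = 4ϖ/3 = 3.4960767391 = Area{x⁴+y² ≤ 1} (python, agreement
10⁻¹⁵); CM Weierstrass stone {−1 ≤ x ≤ 0,
y² ≤ x³ − x}: 0.9585121890 = (4/5)·π/ϖ (pure quasi-period; fit to 10⁻⁹ = quadrature error),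
incommensurable with 4ϖ/3 (Chudnovsky); Weierstrass
stone of y² = 4x³ − 28x + 24 (roots −3, 1, 2; no CM): Ω₀ = 2.0189058200, H = −1.2325555232, Area =
42.876865668; bean stone
{4y² ≤ (1−x²)(2+x)², x ≥ −1}: Area = π exactly (odd part integrates to 0), acnode at (−2,0),
∂ₓp(1,0) = 18, ∂ₓp(−1,0) = −2; rational quartic
ovals O_k : t ↦ ((1−t²)/(1+t²), 2t/(k+t²)): Area(O₁) = π (circle), Area(O₂) = (12 − 8√2)π =
2.1560483378, Area(O₃) = (4 − 2√3)π = 1.6835744290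
(python this session, 4·10⁵ nodes, agreement 10⁻¹⁴); {x⁴+y² ≤ 1} = B(1/4,3/2), {x⁴+y⁴ ≤ 1} =
B(1/4,5/4), {x⁶+y² ≤ 1} =
(2/3)B(1/6,3/2) re-evaluated this session; unit disc π;
Arnold's nodal loop {y² ≤ x² − x⁴, x ≥ 0}: 2/3 (corner at the node — outside the layer, consistent
with the value calibration); Hippocrates'
lune: rational area with two corners. Items at open: 13 (target, assembly, 3 cruxes, 8 supports).

DEFINITION REQUESTS. (1) None to file: the cite fact requested by gen 1 has landed as
`Literature.NumberTheory.Transcendental.completePlaneCurvePeriods_zero_or_transcendental`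
(HuberWustholz2022 Cor. 13.13 / Thm 9.11, cite-only, no `_holds` yet) — literally the hypothesis of
SmoothStonesTranscendental, which keeps it
inlined so the cone stays clean. (2) No new definition: the smooth-stone predicate is inlined in
every item; a convenience `IsSmoothStone` with
an `iff` may be introduced by the first prover in Theorems/. (3) Wanted later (not filed): HW Thm
9.10 for general 1-motives (1-motive
vocabulary) for the dichotomy / CornersCarryLogs prose; Masser2026 (doi:10.4064/aa250815-9-11,
paywalled, acq-02462 / WANTED re-filed) to be
read and cited on the value item when it arrives.

Novelty: Searches (2026-08-15, this seat + gen 1 of the same card): `lit read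
book:huber2022-transcendence-linear-relations-1-periods --grep 'closed
path|transcendental or|Corollary 13.1|Theorem 13.9|Theorem 9.10'` (61 hits; pp. 124–126 READ:
Leibniz 1691 problem, Thm 13.7, Thm 13.9, Prop 13.11,
Cor 13.13); `lit read doi:10.4064/aa250815-9-11` (Masser2026: rc 3 paywalled, WANTED re-filed); `lit
search` this seat: local/hybrid ×2 ('Masser elliptic
integrals and transcendence path integrals', 'transcendence of area enclosed by real algebraic curve
oval closed path period') — searchd rc 75
both times (recorded, not worked around); `--source zbmath` ×3 ('transcendence area oval algebraic
curve closed path period Wüstholz' 0;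
'transcendence of areas of segments of algebraic curves' 0; 'periods closed paths transcendental
zero curve' 0), `--source arxiv` ('Masser elliptic
integrals transcendence areas algebraic curves' 0), `--source openalex` (HTTP 429, daily budget
exhausted); gen 1 today: `lit galaxy search --star all` ×7 ('transcendence of the area bounded by an
algebraic
curve' 0; 'periods of closed paths' 0; 'area of an oval transcendental' 0; 'transcendence of areas'
1 → Serfati on Leibniz; 'integral over a
closed path is either zero or transcendental' 0; 'algebraically integrable ovals' / "Newton's lemma
XXVIII" → Arnold1990 READ §§25–31),
`lit frontier KontsevichZagierPeriods --since 2020` (30 rows; none on areas/ovals), `lit bridges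
KontsevichZagierPeriods --cross any` (30, none);  [refs: 10.4064/aa250815-9-11`, 10.1017/9781009019729, 10.4064/aa250815-9-11, 10.1007/978-3-031-51462-3_14:, book:huber2022-transcendence-linear-relations-1-periods, doi:10.4064/aa250815-9-11, doi:10.1017/9781009019729, doi:10.1007/978-3-031-51462-3_14, Masser2026, Arnold1990, HuberWustholz2022, BreidingKohnSturmfels2024]

Barriers (technique_class: boundary-weight-floor, one-period-transfer): - technique_class: boundary-weight-floor, one-period-transfer
- Literature.Barriers.KontsevichZagierPeriods.noSemialgebraicPrimitive_inv_sub_two: respected and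
used — every Newton–Leibniz move here has a RATIONAL/polynomial primitive given in advance (y for
Green, t on subgraph bands, rational N(t,s) in the unfolding); log/arctan layers are never
integrated out, they are killed by two-variable unfoldings with rational data, exactly the barrier's
lesson.
- Literature.Barriers.KontsevichZagierPeriods.kzConjecture_implies_ellipticPeriods_algIndep: not
engaged — every transcendence input is ℚ̄-LINEAR (HW Cor. 13.13 inlined; Masser only in prose);
products ϖ², ω·η are never claimed transcendental; the layer's values are single complete 1-periods.
- Literature.Barriers.KontsevichZagierPeriods.kzConjecture_implies_twoPiI_log_algIndep: not engaged
— bounding stones compare two algebraic multiples of ONE number π; no log enters a cornerless area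
(weight floor 1).
- Literature.Barriers.KontsevichZagierPeriods.kzConjecture_implies_oddZetaAlgIndep: evaded by the
layer itself — smooth-stone values are complete 1-periods of curves (weights 1–2); ζ(3), MZVs, K3
periods never occur (they start with n ≥ 3 bodies, BoundaryLevel's business).
- Literature.Barriers.KontsevichZagierPeriods.cressonViuSos_prop_3_2: not engaged — no global
semialgebraic homeomorphism between two stones is posited except in ConicStones/BeanStoneDisc
pieces, where the maps are explicit affine/reflection maps; chains ar

History (route lifecycle, newest last):
- 2026-08-16T04:09:55Z · AUTO-CRUX (backfill): VolumeForm — hypotheses of the deciding theorem that nothing in the route derives are cruxes (operator:999:1085951)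
- 2026-08-24T06:55:25Z · DORMANT — reconciler: no traction for 6.6 d (last activity item-proof-filed at 2026-08-17T16:28:40Z); parked, not closed — `ledger route dormant route-KontsevichZagierPer (operator:999:3848581)
- 2026-08-31T08:41:29Z · REACTIVATED (open) — reconciler: reactivated — activity statement-checked at 2026-08-31T07:27:55Z after parking at 2026-08-24T06:55:25Z (operator:999:749727)

sub-problem: KontsevichZagierPeriods · status: open · opened planner-plancard-KontsevichZagierPeriods-Kont-270990d1-g2-0 2026-08-15T18:51:50Z · rev 1 · ledger route-KontsevichZagierPeriods-WeightFloor
GENERATED by the gate from the ledger (D-0016/17). Provers cite these decls: `theorem foo : Summit.KontsevichZagierPeriods.KontsevichZagierPeriods.Theses.WeightFloor.<Decl> := …` in Summits/KontsevichZagierPeriods/KontsevichZagierPeriods/Theorems/<Name>.lean.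
-/

namespace Summit.KontsevichZagierPeriods.KontsevichZagierPeriods.Theses.WeightFloor

open scoped BigOperators Topology Manifold Classical MeasureTheory ProbabilityTheory Matrix InnerProductSpace ComplexConjugate ContinuousMap
open Filter Set Function TopologicalSpace MeasureTheory

attribute [summit_statement] _root_.KontsevichZagierPeriods

open Literature Periods

/-- item stmt-KontsevichZagierPeriods-3814 · crux (kind.auto-crux: conjecture-grade) · rank 0 · open · by planner
why it might fail: summit-equivalent (ViuSos2021 Thm 1.1 / CressonViusos2022 §1: every period is a volume): from N = 3 on it contains π², ζ(3), products of 1-periods (strength barriers); only the smooth-stone layer of N = 2 is claimed here.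
sources: CressonViusos2022, ViuSos2021, KontsevichZagier2001
[target] X — two integrand-1 integral representations of one dimension N with equal value are
KZ-equivalent (volume is the only KZ-invariant of finite-volume ℚ-semialgebraic sets);
summit-equivalent frame of the route, attacked here on the spherical sector. -/
@[route_item "route-KontsevichZagierPeriods-WeightFloor", crux]
def VolumeForm : Prop :=
  ∀ ⦃N : ℕ⦄ (r r' : Literature.NumberTheory.Transcendental.KZ.IntegralRep N), (∀ x ∈ r.domain, r.integrand x = 1) → (∀ x ∈ r'.domain, r'.integrand x = 1) → r.value = r'.value → Literature.NumberTheory.Transcendental.KZ.Equivalent r r'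

/-- item stmt-KontsevichZagierPeriods-12244 · aside · rank 2 · open · by planner
why it might fail: HW relations among complete periods involve non-split torus extensions of J(C) (third-kind parts of x dy at infinity) and CM/isogeny factors; one equal-area pair whose certificate no sheetwise correspondence + plane Stokes chain realises refutes it (and the summit).
sources: HuberWustholz2022, Masser1975, SertozOuaknineWorrell2025, KontsevichZagier2001
[crux] the abelian half of the layer (card (S), hardest): two smooth stones (integrand 1; domains
compact, regular closed, non-empty interior, frontier in the smooth real locus of some p ∈ ℚ[x,y])
with equal area NOT of the form β·π (β real algebraic) are KZ-equivalent. After the Green move both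
areas are complete periods of second/third-kind forms on smooth curves of genus ≥ 1; by
Huber–Wüstholz (Thm 9.10/13.7, cited, a hypothesis of no item) the equality is induced by exact
forms, residues and a correspondence between the generalised Jacobians (isogenies, CM, split
Jacobians as HW Ex. 14.5(3): y² = x⁶+1 → y² = x³+1); the claim is that each certificate is a chain:
fold maps (x,y) ↦ (x²,y) are single 2-dim changes of variables on half-stones, general
correspondences act sheetwise (route MultivaluedCoV), isogenies as in
IsogenyCertificates/HermiteRigidity. Test pairs: {x⁴+y² ≤ 1} (4ϖ/3) against Weierstrass stones of y²
= x³ − x; the genus-2 stone {x⁶+y² ≤ 1} ((2/3)B(1/6,3/2) = 3.6429759718) against stones of its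
elliptic quotients. [deps: GreenBridge] [difficulty: XL] -/
@[route_item "route-KontsevichZagierPeriods-WeightFloor"]
def AbelianStonePairs : Prop :=
  ∀ (r r' : Literature.NumberTheory.Transcendental.KZ.IntegralRep 2), (∀ x ∈ r.domain, r.integrand x = 1) → (∀ x ∈ r'.domain, r'.integrand x = 1) → (IsCompact r.domain ∧ closure (interior r.domain) = r.domain ∧ (interior r.domain).Nonempty ∧ ∃ p : MvPolynomial (Fin 2) ℚ, frontier r.domain ⊆ {x | MvPolynomial.aeval x p = 0 ∧ ∃ i, MvPolynomial.aeval x (MvPolynomial.pderiv i p) ≠ 0}) → (IsCompact r'.domain ∧ closure (interior r'.domain) = r'.domain ∧ (interior r'.domain).Nonempty ∧ ∃ p : MvPolynomial (Fin 2) ℚ, frontier r'.domain ⊆ {x | MvPolynomial.aeval x p = 0 ∧ ∃ i, MvPolynomial.aeval x (MvPolynomial.pderiv i p) ≠ 0}) → (¬ ∃ β : ℝ, IsAlgebraic ℚ β ∧ r.value = β * Real.pi) → r.value = r'.value → Literature.NumberTheory.Transcendental.KZ.Equivalent r r'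

/-- item stmt-KontsevichZagierPeriods-12245 · aside · rank 3 · open · by planner
why it might fail: beyond genus 0 'Area = βπ' is certified by residues on a 2-chain in the complexified curve; as moves this needs Stokes on a semialgebraic 2-chain in ℝ⁴ (open crux of UnfoldedStokes); the first case (one-oval dividing sextic, genus 2) may admit no such chain.
sources: HuberWustholz2022, KontsevichZagier2001, Arnold1990, BochnakCosteRoy1998
[crux] the bounding half: two smooth stones with equal area of the form β·π (β real algebraic) are
KZ-equivalent. Expected to be exactly the case where the oriented boundary cycle bounds in the
complexified curve, Area = 2πi·Σ res(x dy) (all genus-0 stones; ovals of one-oval dividing curves of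
even genus); the chain must realise the residue theorem — by a rational parametrisation (genus 0:
crux GenusZeroStonePairs) or by Stokes on a ℚ-semialgebraic 2-chain of the complex curve in ℝ⁴
(UnfoldedStokes' engine) — and then connect two π-multiples through the disc normal form [ℝ,
β/(1+t²)] ~ disc of radius √β (one change of variables with algebraic Jacobian). [deps: GreenBridge,
GenusZeroStonePairs] [difficulty: L] -/
@[route_item "route-KontsevichZagierPeriods-WeightFloor"]
def BoundingStonePairs : Prop :=
  ∀ (r r' : Literature.NumberTheory.Transcendental.KZ.IntegralRep 2), (∀ x ∈ r.domain, r.integrand x = 1) → (∀ x ∈ r'.domain, r'.integrand x = 1) → (IsCompact r.domain ∧ closure (interior r.domain) = r.domain ∧ (interior r.domain).Nonempty ∧ ∃ p : MvPolynomial (Fin 2) ℚ, frontier r.domain ⊆ {x | MvPolynomial.aeval x p = 0 ∧ ∃ i, MvPolynomial.aeval x (MvPolynomial.pderiv i p) ≠ 0}) → (IsCompact r'.domain ∧ closure (interior r'.domain) = r'.domain ∧ (interior r'.domain).Nonempty ∧ ∃ p : MvPolynomial (Fin 2) ℚ, frontier r'.domain ⊆ {x | MvPolynomial.aeval x p = 0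 ∧ ∃ i, MvPolynomial.aeval x (MvPolynomial.pderiv i p) ≠ 0}) → (∃ β : ℝ, IsAlgebraic ℚ β ∧ r.value = β * Real.pi) → r.value = r'.value → Literature.NumberTheory.Transcendental.KZ.Equivalent r r'

/-- item stmt-KontsevichZagierPeriods-12246 · aside · rank 4 · open · by planner
why it might fail: false only with the summit; the risk is the engine — Newton–Leibniz needs primitives continuous on CLOSED fibres after compactifying ℝ, critical points of X(t) must be cut by null walls, and a log bracket resisting rational unfolding makes it as hard as PlanarAreas.
sources: KontsevichZagier2001, HuberWustholz2022, BochnakCosteRoy1998, Baker1975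
[crux] genus-zero stones (special case of crux 3, FIRST prover target, transcendence-free): if the
frontiers of both stones are covered by finitely many rational arcs t ↦ (u/w, v/w)(t) with
real-algebraic coefficients (w without real zeros), equal area implies KZ-equivalence. Engine: Green
(support GreenBridge: bands, primitive y) → one change of variables per monotone arc x = X(t) turns
[τ, y_branch] into [J, Y·X′] with RATIONAL integrand over ℚ̄∩ℝ → compactify/merge to [ℝ, R], R =
O(t⁻²) without real poles, ∫R = βπ, β = 2i·Σ_{Im>0} res ∈ ℚ̄∩ℝ → partial fractions (rule 1b,
integrable pieces only): Cauchy kernels δa/((t−b)²+a²) ↦ [ℝ, δ/(1+t²)] by the affine change t ↦ b +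
a t, merged by 1b into [ℝ, β/(1+t²)]; higher-order poles telescope by Newton–Leibniz with RATIONAL
primitives after t = s/(1−s²); each log-divergent bracket (t−b)/((t−b)²+a²) − t/(t²+1) (coefficients
sum to 0 by integrability) is killed by a rational UNFOLDING: it equals ∫₀¹
∂_s[(t−b(s))/((t−b(s))²+a(s)²)] ds along the segment (b(s), a(s)) = (sb, 1+s(a−1)), the integrand is
∂_t N with N = (a a′ − (t−b) b′)/((t−b)²+a²) rational and → 0 at t = ±∞, so Newton–Leibniz in s
(backwards), the swap (t,s) ↦ (s,t) and Newton -/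
@[route_item "route-KontsevichZagierPeriods-WeightFloor"]
def GenusZeroStonePairs : Prop :=
  ∀ (r r' : Literature.NumberTheory.Transcendental.KZ.IntegralRep 2), (∀ x ∈ r.domain, r.integrand x = 1) → (∀ x ∈ r'.domain, r'.integrand x = 1) → (IsCompact r.domain ∧ closure (interior r.domain) = r.domain ∧ (interior r.domain).Nonempty ∧ ∃ p : MvPolynomial (Fin 2) ℚ, frontier r.domain ⊆ {x | MvPolynomial.aeval x p = 0 ∧ ∃ i, MvPolynomial.aeval x (MvPolynomial.pderiv i p) ≠ 0}) → (IsCompact r'.domain ∧ closure (interior r'.domain) = r'.domain ∧ (interior r'.domain).Nonempty ∧ ∃ p : MvPolynomial (Fin 2) ℚ, frontier r'.domain ⊆ {x | MvPolynomial.aeval x p = 0 ∧ ∃ i, MvPolynomial.aeval x (MvPolynomial.pderiv i p) ≠ 0}) → (∃ (k : ℕ) (u v w : Fin k → Polynomial ℝ), (∀ i n, IsAlgebraic ℚ ((u i).coeff n) ∧ IsAlgebraic ℚ ((v i).coeff n) ∧ IsAlgebraic ℚ ((w i).coeff n)) ∧ (∀ i t, (w i).eval t ≠ 0) ∧ frontier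 r.domain ⊆ ⋃ i, closure (Set.range fun t : ℝ => (![(u i).eval t / (w i).eval t, (v i).eval t / (w i).eval t] : Fin 2 → ℝ))) → (∃ (k : ℕ) (u v w : Fin k → Polynomial ℝ), (∀ i n, IsAlgebraic ℚ ((u i).coeff n) ∧ IsAlgebraic ℚ ((v i).coeff n) ∧ IsAlgebraic ℚ ((w i).coeff n)) ∧ (∀ i t, (w i).eval t ≠ 0) ∧ frontier r'.domain ⊆ ⋃ i, closure (Set.range fun t : ℝ => (![(u i).eval t / (w i).eval t, (v i).eval t / (w i).eval t] : Fin 2 → ℝ))) → r.value = r'.value → Literature.NumberTheory.Transcendental.KZ.Equivalent r r'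

/-- item stmt-KontsevichZagierPeriods-12247 · support · rank 9 · open · by planner
sources: KontsevichZagier2001, HuberWustholz2022, BochnakCosteRoy1998
[support] THE LAYER (card (S)): two integrand-1 representations over smooth stones (compact, regular
closed, non-empty interior, frontier in the smooth real locus of some p ∈ ℚ[x,y]) with equal area
are KZ-equivalent. A literal special case of VolumeForm (support LayerOfFrame) and of PlanarAreas
(stmt-4990); closes from cruxes 2 and 3 by StoneDichotomy. Frontier bookkeeping used throughout: for
such σ the frontier is open and closed in the 1-manifold {p = 0, ∇p ≠ 0}(ℝ) (local two-sidedness of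
a regular closed set along a smooth arc), hence a finite union of whole ovals, and σ is the closure
of a union of complementary components. [difficulty: XL] -/
@[route_item "route-KontsevichZagierPeriods-WeightFloor"]
def SmoothOvalSector : Prop :=
  ∀ (r r' : Literature.NumberTheory.Transcendental.KZ.IntegralRep 2), (∀ x ∈ r.domain, r.integrand x = 1) → (∀ x ∈ r'.domain, r'.integrand x = 1) → (IsCompact r.domain ∧ closure (interior r.domain) = r.domain ∧ (interior r.domain).Nonempty ∧ ∃ p : MvPolynomial (Fin 2) ℚ, frontier r.domain ⊆ {x | MvPolynomial.aeval x p = 0 ∧ ∃ i, MvPolynomial.aeval x (MvPolynomial.pderiv i p) ≠ 0}) → (IsCompact r'.domain ∧ closure (interior r'.domain) = r'.domain ∧ (interior r'.domain).Nonempty ∧ ∃ p : MvPolynomial (Fin 2) ℚ, frontier r'.domain ⊆ {x | MvPolynomial.aeval x p = 0 ∧ ∃ i, MvPolynomial.aeval x (MvPolynomial.pderiv i p) ≠ 0}) → r.value = r'.value → Literature.NumberTheory.Transcendental.KZ.Equivalent r r'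

/-- item stmt-KontsevichZagierPeriods-12248 · support · rank 9 · closed · proved by Summit.KontsevichZagierPeriods.WeightFloor.stoneDichotomy_proof @ 3128db2c0e22 (prover) · by planner
sources: KontsevichZagier2001
[support] glue of the layer (pure logic, proved in the folder's Sketch.lean as
`stoneDichotomy_holds`, 4 lines): BoundingStonePairs → AbelianStonePairs → SmoothOvalSector, by
excluded middle on '∃ β real algebraic, Area = β·π'. [difficulty: provable-now] -/
@[route_item "route-KontsevichZagierPeriods-WeightFloor"]
def StoneDichotomy : Prop :=
  BoundingStonePairs → AbelianStonePairs → SmoothOvalSector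

-- `StoneDichotomy` holds: proved by `Summit.KontsevichZagierPeriods.WeightFloor.stoneDichotomy_proof` @ 3128db2c0e22 (its module imports this route file, so no `_holds` link can be stated here).

/-- item stmt-KontsevichZagierPeriods-12249 · support · rank 9 · closed · proved by Summit.KontsevichZagierPeriods.WeightFloor.layerOfFrame_proof @ 3128db2c0e22 (prover) · by planner
sources: KontsevichZagier2001
[support] the layer is a specialisation of the frame: VolumeForm → SmoothOvalSector (proved in
Sketch.lean as `layerOfFrame_holds`, 2 lines; with `volumeForm_of_summit` there it makes the kill
criterion formal: ¬SmoothOvalSector ⇒ ¬VolumeForm ⇒ ¬summit). [difficulty: provable-now] -/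
@[route_item "route-KontsevichZagierPeriods-WeightFloor"]
def LayerOfFrame : Prop :=
  VolumeForm → SmoothOvalSector

-- `LayerOfFrame` holds: proved by `Summit.KontsevichZagierPeriods.WeightFloor.layerOfFrame_proof` @ 3128db2c0e22 (its module imports this route file, so no `_holds` link can be stated here).

/-- item stmt-KontsevichZagierPeriods-12250 · support · rank 9 · open · by planner
sources: KontsevichZagier2001, BasuPollackRoy2006, BochnakCosteRoy1998
[support] the Green move inside the rules (card W1): every integrand-1 representation over a smooth
stone is congruent modulo `KZ.relations` to a ℤ-combination of 1-dimensional representations (typed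
loosely as membership in the closure of 1-dim generators; the intended chain: cylindrical
decomposition of the stone into vertical bands — rule 1a, null walls are relations — and ONE
Newton–Leibniz move per band with the polynomial primitive F = y, producing integrands y_top(x) −
y_bot(x), real branches of the boundary curve, split by 1b; provers of cruxes 2–4 re-prove the sharp
form they need with `--supports`). [difficulty: M] -/
@[route_item "route-KontsevichZagierPeriods-WeightFloor"]
def GreenBridge : Prop :=
  ∀ (r : Literature.NumberTheory.Transcendental.KZ.IntegralRep 2), (∀ x ∈ r.domain, r.integrand x = 1) → (IsCompact r.domain ∧ closure (interior r.domain) = r.domain ∧ (interior r.domain).Nonempty ∧ ∃ p : MvPolynomial (Fin 2) ℚ, frontier r.domain ⊆ {x | MvPolynomial.aeval x p = 0 ∧ ∃ i, MvPolynomial.aeval x (MvPolynomial.pderiv i p) ≠ 0}) → ∃ c ∈ AddSubgroup.closure {x : Literature.NumberTheory.Transcendental.KZ.FormalRep | ∃ (s : Literature.NumberTheory.Transcendental.KZ.IntegralRep 1), x = Literature.NumberTheory.Transcendental.KZ.of s}, Literature.NumberTheory.Transcendental.KZ.of r - c ∈ Literature.NumberTheory.Transcendental.KZ.relations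

/-- item stmt-KontsevichZagierPeriods-12251 · support · rank 9 · closed · proved by Summit.KontsevichZagierPeriods.WeightFloor.conicStones_proof @ a58c3ebfaf07 (prover) · by planner
sources: KontsevichZagier2001, BochnakCosteRoy1998
[support] sanity anchor (d = 2 analogue of LowDimension's DimZero): two smooth stones cut out by
polynomials of total degree ≤ 2 — necessarily filled ellipses over ℚ (no compact regular-closed set
has its frontier inside two lines minus their crossing, a parabola or the empty smooth locus) — with
equal area are KZ-equivalent: ONE affine change of variables Φ = A′^(−1/2)A^(1/2) (+ translations)
with real-algebraic entries and det Φ = 1 (equal areas π/√det A = π/√det A′), whose graph is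
ℚ-semialgebraic; e.g. {x²+4y² ≤ 4} ~ {x²+y² ≤ 2} via (x,y) ↦ (x/√2, √2·y). [difficulty:
provable-now] -/
@[route_item "route-KontsevichZagierPeriods-WeightFloor"]
def ConicStones : Prop :=
  ∀ (r r' : Literature.NumberTheory.Transcendental.KZ.IntegralRep 2), (∀ x ∈ r.domain, r.integrand x = 1) → (∀ x ∈ r'.domain, r'.integrand x = 1) → (IsCompact r.domain ∧ closure (interior r.domain) = r.domain ∧ (interior r.domain).Nonempty ∧ ∃ p : MvPolynomial (Fin 2) ℚ, p.totalDegree ≤ 2 ∧ frontier r.domain ⊆ {x | MvPolynomial.aeval x p = 0 ∧ ∃ i, MvPolynomial.aeval x (MvPolynomial.pderiv i p) ≠ 0}) → (IsCompact r'.domain ∧ closure (interior r'.domain) = r'.domain ∧ (interior r'.domain).Nonempty ∧ ∃ p : MvPolynomial (Fin 2) ℚ, p.totalDegree ≤ 2 ∧ frontier r'.domain ⊆ {x | MvPolynomial.aeval x p = 0 ∧ ∃ i, MvPolynomial.aeval x (MvPolynomial.pderiv i p) ≠ 0}) → r.value = r'.value → Literature.NumberTheory.Transcendental.KZ.Equivalent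 r r'

-- `ConicStones` holds: proved by `Summit.KontsevichZagierPeriods.WeightFloor.conicStones_proof` @ a58c3ebfaf07 (its module imports this route file, so no `_holds` link can be stated here).

/-- item stmt-KontsevichZagierPeriods-12252 · support · rank 9 · closed · proved by Summit.KontsevichZagierPeriods.WeightFloor.beanStoneDisc_proof @ e69e2d96c9ad (prover) · by planner
sources: KontsevichZagier2001, BochnakCosteRoy1998
[support] first closed instance of the layer between DIFFERENT curves (calibration of GreenBridge +
GenusZeroStonePairs, provable now): the bean stone K = {4y² ≤ (1−x²)(2+x)², x ≥ −1} — bounded by the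
smooth oval of the rational quartic 4y² = (1−x²)(2+x)² = image of θ ↦ (cos θ, sin θ(1 + ½cos θ)),
whose only singularity is the acnode (−2, 0), cut away by x ≥ −1; ∇p ≠ 0 on the oval (∂ₓp = 18, −2
at (±1, 0)) — has Area = ∫_(−1)^1 2√(1−x²)(1 + x/2) dx = π + 0 and is KZ-equivalent to the unit
disc: Green on both sides (bands over (−1,1), primitive y), 1b splits 2√(1−x²)(1+x/2) = 2√(1−x²) +
x√(1−x²), the odd summand dies by the change x ↦ −x on (−1,0) plus 1b ([(0,1), x√(1−x²)] + [(0,1),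
−x√(1−x²)] = [(0,1), 0]), and [(-1,1), 2√(1−x²)] is the disc after its own Green move. [difficulty:
M] -/
@[route_item "route-KontsevichZagierPeriods-WeightFloor"]
def BeanStoneDisc : Prop :=
  ∀ (r r' : Literature.NumberTheory.Transcendental.KZ.IntegralRep 2), r.domain = {v : Fin 2 → ℝ | 4 * v 1 ^ 2 ≤ (1 - v 0 ^ 2) * (2 + v 0) ^ 2 ∧ -1 ≤ v 0} → (∀ x ∈ r.domain, r.integrand x = 1) → r'.domain = {v : Fin 2 → ℝ | v 0 ^ 2 + v 1 ^ 2 ≤ 1} → (∀ x ∈ r'.domain, r'.integrand x = 1) → Literature.NumberTheory.Transcendental.KZ.Equivalent r r'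

-- `BeanStoneDisc` holds: proved by `Summit.KontsevichZagierPeriods.WeightFloor.beanStoneDisc_proof` @ e69e2d96c9ad (its module imports this route file, so no `_holds` link can be stated here).

/-- item stmt-KontsevichZagierPeriods-12253 · support · rank 9 · open · by planner
sources: HuberWustholz2022, Wustholz1989, Arnold1990, Masser2026
[support] VALUE CALIBRATION — Leibniz's 1691 problem for whole ovals (card (T1a), 'a smooth stone
never weighs an algebraic amount'; known modulo bookkeeping, hence support): ASSUMING the
plane-curve closed-path form of HuberWustholz2022 Cor. 13.13 (with Thm 9.10/9.11 for several
components), INLINED as the hypothesis so that no cite-only fact enters the cone (for p, A, B ∈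
ℚ[x,y] and finitely many C¹ 1-periodic loops γᵢ in the smooth COMPLEX locus of p = 0, an algebraic
value of Σ nᵢ∮_γᵢ(A dx + B dy) is zero), every smooth stone σ has transcendental area. Proof:
frontier σ = finitely many whole ovals in the smooth real locus, Area(σ) = Σ ±∮ x dy > 0
(Green/Fubini band by band), apply the hypothesis with A = 0, B = x. By soundness
(`KZ.relations_le_ker_eval_holds`, proved) it separates every smooth stone from every representation
with algebraic value (polygons; Arnold's nodal lemniscate loop {y² ≤ x² − x⁴, x ≥ 0} of area 2/3,
corner at the node). The hypothesis is to be vendored as a Literature fact (Definition requests) and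
the item then restated `(h : fact) → …`. [difficulty: L] -/
@[route_item "route-KontsevichZagierPeriods-WeightFloor"]
def SmoothStonesTranscendental : Prop :=
  (∀ (p A B : MvPolynomial (Fin 2) ℚ) (k : ℕ) (n : Fin k → ℤ) (γ : Fin k → ℝ → (Fin 2 → ℂ)), (∀ i, ContDiff ℝ 1 (γ i) ∧ Function.Periodic (γ i) 1 ∧ ∀ t, MvPolynomial.aeval (γ i t) p = 0 ∧ ∃ j, MvPolynomial.aeval (γ i t) (MvPolynomial.pderiv j p) ≠ 0) → IsAlgebraic ℚ (∑ i, (n i : ℂ) * ∫ t in (0:ℝ)..1, (MvPolynomial.aeval (γ i t) A * deriv (fun s => γ i s 0) t + MvPolynomial.aeval (γ i t) B * deriv (fun s => γ i s 1) t)) → (∑ i, (n i : ℂ) * ∫ t in (0:ℝ)..1, (MvPolynomial.aeval (γ i t) A * deriv (fun s => γ i s 0) t + MvPolynomial.aeval (γ i t) B * deriv (fun s => γ i s 1) t)) = 0) → ∀ (σ : Set (Fin 2 → ℝ)), IsCompact σ → closure (interior σ) = σ → (interior σ).Nonempty → (∃ p : MvPolynomial (Fin 2) ℚ, frontier σ ⊆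 {x | MvPolynomial.aeval x p = 0 ∧ ∃ i, MvPolynomial.aeval x (MvPolynomial.pderiv i p) ≠ 0}) → Transcendental ℚ (MeasureTheory.volume σ).toReal

/-- item stmt-KontsevichZagierPeriods-13936 · support · rank 9 · closed · proved by Summit.KontsevichZagierPeriods.WeightFloor.fermatQuarticStone_proof @ b335b53dd207 (prover) · by planner
sources: KontsevichZagier2001, AndrewsAskeyRoy1999, HuberWustholz2022
[support] first ABELIAN instance, curves of different genus (calibration of AbelianStonePairs,
provable now, transcendence-free): the quartic egg {x⁴ + y² ≤ 1} (y² = 1 − x⁴, genus 1, CM by i;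
area B(1/4,3/2) = 4ϖ/3) and the Fermat stone {x⁴ + y⁴ ≤ 8/9} (genus 3; area (8/9)^(1/2)·B(1/4,5/4) =
4ϖ/3, as B(1/4,3/2)/B(1/4,5/4) = 2√2/3) are KZ-equivalent. Chain on paper: Green on both; x =
(8/9)^(1/4)u; symmetry + t = x⁴ give Beta representations on (0,1); integration by parts =
Newton–Leibniz with the algebraic primitives λ·t^a(1−t)^b gives B(1/4,3/2) = (2/3)B(1/4,1/2),
B(1/4,5/4) = (1/2)B(1/4,1/4); the duplication B(1/4,1/4) = √2·B(1/4,1/2) is (0,½) ∪ (½,1), t ↦ 1−t,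
u = 4t(1−t) (LowdimDuplicationOneThird's pattern at a = 1/4); both sides end at [(0,1),
(2/3)t^(−3/4)(1−t)^(−1/2)]. Certificate behind it: the quotient of the Fermat quartic onto y² = 1 −
x⁴. [difficulty: L] -/
@[route_item "route-KontsevichZagierPeriods-WeightFloor"]
def FermatQuarticStone : Prop :=
  ∀ (r r' : Literature.NumberTheory.Transcendental.KZ.IntegralRep 2), r.domain = {v : Fin 2 → ℝ | v 0 ^ 4 + v 1 ^ 2 ≤ 1} → (∀ x ∈ r.domain, r.integrand x = 1) → r'.domain = {v : Fin 2 → ℝ | v 0 ^ 4 + v 1 ^ 4 ≤ 8 / 9} → (∀ x ∈ r'.domain, r'.integrand x = 1) → Literature.NumberTheory.Transcendental.KZ.Equivalent r r'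

-- `FermatQuarticStone` holds: proved by `Summit.KontsevichZagierPeriods.WeightFloor.fermatQuarticStone_proof` @ b335b53dd207 (its module imports this route file, so no `_holds` link can be stated here).

/-- item stmt-KontsevichZagierPeriods-3822 · assembly · rank 1 · closed · proved by Summit.KontsevichZagierPeriods.VolumeFormAssembly.symplecticScissors_assembly_proof (prover) · by planner
sources: ViuSos2021, CressonViusos2022, KontsevichZagier2001
[assembly] VolumeForm → KontsevichZagierPeriods (difference of volumes + slabs + gluing +
soundness). -/
@[route_item "route-KontsevichZagierPeriods-WeightFloor", crux]
def Assembly : Prop :=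
  VolumeForm → KontsevichZagierPeriods

-- `Assembly` holds: proved by `Summit.KontsevichZagierPeriods.VolumeFormAssembly.symplecticScissors_assembly_proof` (its module imports this route file, so no `_holds` link can be stated here).

/-! D-0027 §2.1 — DECIDING THEOREM (planner-authored via `route open/edit --closes-file`; by planner-plancard-KontsevichZagierPeriods-Kont-270990d1-g2-0 2026-08-15T18:51:51Z):
its hypotheses are this route's items and its conclusion the sub-problem Statement (glue_lint), and it elaborates with this file. -/

@[closes "route-KontsevichZagierPeriods-WeightFloor"] theorem closes (hV : VolumeForm) (hA : Assembly) : KontsevichZagierPeriods :=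
  hA hV

end Summit.KontsevichZagierPeriods.KontsevichZagierPeriods.Theses.WeightFloor
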